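import Mathlib
import Summits.CriticalPhenomena.CardyFormulaZ2.Theorems.CardySelfRefinementTrivialSectorRateStubBoundaryRelevanceThreeArmFreeWindow
import Summits.CriticalPhenomena.CardyFormulaZ2.Theorems.CardySelfRefinementTrivialSectorRateStubBoundaryRelevanceThreeArmFreeInclusion
import Summits.CriticalPhenomena.CardyFormulaZ2.Theorems.CardySelfRefinementTrivialSectorRateStubBoundaryRelevanceTwoArmWindowAlong
import HarnessLib

/-!
# Helper (W2) of stub `stub_boundaryRelevance`, line `far-field-is-a-quarter-turn`
(crux `TrivialSectorRate`, stmt-CriticalPhenomena-10266): the `k = 2` FREE-SIDE docked half-plane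
THREE-ARM WINDOW BOUND along an RSW path, unconditionally

Near a FREE side of a quad the pivotality of a boundary box forces the docked half-plane pattern
(open, closed-dual, open) — two open arms docked in the window with a closed dual arm docked
between them.  For the self-refinement model `M_2(γ s)` (uniformly in the path parameter of an
admissible path, `PathOK 2 γ`, and in the vertical offset `t` of the boundary line) this ordered
free three-arm window event has probability `≤ C (m/n)^{1+α}` for windows of `m` sites at scale
`n` and reach `R ≥ K n`:

* `threeArmFree_window_along` — the bound, exponent `1 + α > 1`.

Assembly of three landed files: the coin-space inclusion
`preimage_cfg_threeArmFree_subset_disjointOccurrence` (file `…ThreeArmFreeInclusion.lean`: for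
`k = 2` two open sub-edges of one bundle share a vertex, so by Werner's planar trapping
`Z2HalfPlane.interlace` the two open arms never meet a common bundle, and opposite-state pairs have
coin-disjoint certificates, `exists_disjoint_coinCertificates_of_oppositeStates`), the conditional
bound `threeArmFree_window_along_two` (file `…ThreeArmFreeWindow.lean`: Reimer's inequality on the
coin product, the one-arm decays along the path) and the two-arm window bound `twoArm_window_along`
(file `…TwoArmWindowAlong.lean`, exponent exactly `1`).

Scope (c4 obstruction map): this is the one of the four boundary cases (free/wired side ×
`k = 2, 3`) of (HB) that the tree's coin-space Reimer technology reaches; the wired pattern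
(closed, open, closed) and the `k = 3` free pattern meet same-state pinches through one bundle that
no read-out certifies disjointly (exploration / arm-separation technology for `M_k` is needed).

References: G. F. Lawler, O. Schramm, W. Werner, Electron. J. Probab. 7 (2002), Appendix A;
D. Reimer, Combin. Probab. Comput. 9 (2000); W. Werner, PCMI Lecture Notes (2007), Lecture 2.
-/

noncomputable section

namespace Summit.CriticalPhenomena.CardyFormulaZ2.Theorems.CardySelfRefinement.FarField

open Set MeasureTheory
open Literature.Probability.LatticeModels Literature.Probability.Percolation
open Literature.Probability.Percolation.QuadCrossing
open Summit.CriticalPhenomena.CardyFormulaZ2.Theses.CardySelfRefinement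

/-- **The `k = 2` free-side docked three-arm window bound along an RSW path** (unconditional):
for `PathOK 2 γ` there are `C, α > 0` and `K ≥ 1` such that for every path parameter `s`, every
vertical offset `t`, every window `[j, j+m)` and all `1 ≤ m ≤ n`, `K n ≤ R`, the
`M_2(γ s)`-probability that the configuration translated by `(0,t)` has two open arms docked at
open legs `a < a'` of the window, to sup-distance `R`, and a closed dual arm from a moat face `b`,
`a ≤ b < a'`, to sup-distance `2R`, is at most `C (m/n)^{1+α}`. -/
theorem threeArmFree_window_along {γ : unitInterval → ℝ × ℝ} (hγ : PathOK 2 γ) :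
    ∃ C α : ℝ, 0 < C ∧ 0 < α ∧ ∃ K : ℕ, 1 ≤ K ∧ ∀ (s : unitInterval) (t j : ℤ) (m n R : ℕ),
      1 ≤ m → m ≤ n → K * n ≤ R →
        (M 2 (γ s).1 (γ s).2).real
          (BondConfig.relabel (sym2Equiv (Site.shift (![0, t] : Site 2))) ⁻¹'
            {ω | ∃ a b a' : ℤ, (j ≤ a ∧ a ≤ b ∧ b < a' ∧ a' < j + m) ∧
              Z2HalfPlane.leg a ∈ ω ∧ Z2HalfPlane.leg a' ∈ ω ∧
              (∃ v : Site 2, Z2HalfPlane.Far R a v ∧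
                ω ∈ openConnIn ↑(Z2HalfPlane.siteBox a R) ![a, 0] v) ∧
              (∃ v' : Site 2, Z2HalfPlane.Far R a' v' ∧
                ω ∈ openConnIn ↑(Z2HalfPlane.siteBox a' R) ![a', 0] v') ∧
              ∃ g : Site 2, Z2HalfPlane.Far (2 * R) b g ∧
                dualConfig ω ∈ openConnIn ↑(Z2HalfPlane.faceBox b (2 * R)) ![b, -1] g}) ≤
          C * ((m : ℝ) / n) ^ (1 + α) :=
  threeArmFree_window_along_two hγ
    (fun t j m R hmR => preimage_cfg_threeArmFree_subset_disjointOccurrence t j m R hmR)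
    (twoArm_window_along (Or.inl rfl) hγ)

end Summit.CriticalPhenomena.CardyFormulaZ2.Theorems.CardySelfRefinement.FarField

end
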